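import Literature.MathematicalPhysics.QuantumFieldTheory.Balaban1983to89.QGQInverse
import Literature.MathematicalPhysics.QuantumFieldTheory.Balaban1983to89.B11Reparam190

/-!
# Bałaban, *Propagators for lattice gauge theories in a background field*, Commun. Math. Phys. **99** (1985) 389–434 —
# THE TWO PROPAGATOR LETTERS OF ROW (D4)'s NODE D AT THE ORIGIN (Thm 3.3 (3.42)₀ for `G₀ = Δ_a⁻¹`; the coercivity of
# `QG₀Q*`) FROM INVERSE-FREE DATA: THE POSITIVITY OF `Δ_a` (Thm 3.11), ITS LOCALITY, AND THE SURJECTIVITY OF `Q`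

statement-level skeleton of published theorems with citation tags; proofs where landed; nothing here is a claim about the
Yang–Mills mass gap (HONEST FRAMING, cell rule: discharging `BetaPertH` would make Bałaban's UV stability unconditional — a constructive-QFT
result; it is NOT the continuum limit and NOT the Clay problem; this module discharges NOTHING of `BetaPertH`).

CITATION HEADER (lean-in-tree rule 2026-08-18).  Source: T. Bałaban, Commun. Math. Phys. **99** (1985) 389–434,
doi:10.1007/BF01206996 [Balaban1985BackgroundPropagators] (cell paper B9 = [5] of [15]; held
`paper:balaban1985-cmp99-background-propagators`, journal page = PDF page + 388): Thm 3.3 p. 399 with (3.42) p. 397 (*"under the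
assumptions of Theorem 3.1, and with the constants described there … with G′(U) replaced by G(U)"*), Thm 3.11 p. 416 (*"the
operators Δ′_a, G′, (Q′G′²Q′*)⁻¹, Δ_a, G are positive definite"*), (3.26)–(3.27) p. 395 (`Δ_a(U) = Δ(U) + D_UR(U)D*_U + Q(U)*𝔞Q(U)`,
`G = Δ_a⁻¹`), (3.132)–(3.133) p. 422; consumer T. Bałaban, Commun. Math. Phys. **102** (1985) 277–309 [Balaban1985Variational]
(B11 = [15]) p. 297 after (128) (*"Δ_a = Δ + DRD* + Q*aQ (the constant a = 1). For the operator Δ_a⁻¹ = G we have proved Theorem 3.3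
in [5], and especially the bounds (3.42)"*), (129)–(130), (190) p. 308; geometry T. Bałaban, Commun. Math. Phys. **96** (1984) 223–250
[Balaban1984PropagatorsII] (B6 = [3]) (2.51)–(2.54) pp. 232–233, Lemma 2.1 (2.61) p. 234; mechanism J.-M. Combes, L. Thomas, Commun.
Math. Phys. **34** (1973) 251–270 [CombesThomas1973] §II (`QGQInverse.inverse_decay`), and the Schur-complement variational
principle (`QGQInverse.qgq_coercive_of_test_family`).

WHY THIS FILE (audit cell `pub-balaban`, BINDER row (D4), OWNER lineage `b2b-balaban-beta-an4`, gen 107).  Gen 106 left NODE D of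
row (D4) at the origin `B = 0`, in a background field, on exactly TWO analytic letters about Bałaban's one-step BOND operator
(`Beta.RemainderOriginCoercive.ineq190_origin_of_coercive`): `hG0` — [5] Thm 3.3 (3.42), first entry, for `G₀ = Δ_a⁻¹`
(a block majorant `Be^{−δ₁d}`), and `hco` — a coercivity constant `γ` of the matrix `S` of `QG₀Q*`.  Both speak of the INVERSE
`Δ_a⁻¹`.  THIS FILE derives both, on the row's finite real carriers (fields = `m → ℝ` with a block map `blk : m → 𝔅`, `Q`-images =
`p → ℝ`), from INVERSE-FREE data: (A1) `Δ_a` symmetric and `γ_a`-coercive, `γ_a > 0` — the CONTENT of [5] Thm 3.11 (*"Δ_a, G are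
positive definite"*; for the cell's NE9 chain the bond operator `D*D + DR(U)D* + aQ(U)*Q(U)` is a term and its small-field
coercivity at a fixed lattice is `B9Thm311SmallFieldCoercivity.exists_coercive_principal_of_small_field`); (A2) the LOCALISATION of
`Δ_a` as the entry decay `|Δ_a(i,j)| ≤ C_ae^{−δ_ad(blk i, blk j)}` — for the finite-range parts `Δ_U`, `Q*Q` automatic (bounded
coefficients, §1); for the gauge-fixing part `D_UR(U)D*_U` it is the kernel decay of the orthogonal projection `R(U)` onto `Δ_UN(Q′)`
((3.21)–(3.22) p. 394), i.e. of the SITE operators `G′(U)`, `(Q′G′²Q′*)⁻¹` of [5] Thms 3.1–3.2 — the cell's NE9 programme's objects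
(`B9Eq342*`; `Beta.RemainderHasMajGreenPrime` reads `G′(U)`'s majorant at one step), composed with `D`, `D*` (finite range); (A4) the
uniform SURJECTIVITY of the averaging operator, `QQᵀ` is `c_Q`-coercive (a property of `Q` ALONE — at `U = 1` the tube averages of [3]
(2.6), in a background the written repair's Lemma W ∕ (P′2), `HOME/b2b-balaban-r1/QGQ-inverse-proof.md` §5).  Then:
* §1 **`abs_entry_le_exp_of_range`** — (A2) automatic: range `R` and entry bound `a` give the decay shape `ae^{δR}·e^{−δd}`.
* §2 **`rowSum_abs_le` ∕ `colSum_abs_le` ∕ `form_le_of_decay`** — the quadratic form of a matrix with entry decay `Ce^{−δd}`, at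
  most `N` indices per block and the row sum (2.61) at a rate `σ ≤ δ` with constant `c`, is bounded ABOVE by `Λ‖v‖²`, `Λ = C·N·c`
  (finite Schur test `QGQInverse.form_abs_le_of_schur`).
* §2b **`form_conj_proj_le`** — the gauge-fixing term costs nothing in `Λ`: for a symmetric idempotent `R` (the orthogonal projection
  `R(U)` of (3.21)), `⟨v, DRDᵀv⟩ ≤ ⟨v, DDᵀv⟩` — so the coercivity letter needs NO decay of `R(U)`, only the finite-range pieces of `Δ_a`
  and `‖R‖ ≤ 1`; **`sq_mulVec_le_of_rowcol`** — `‖Qv‖² ≤ RrCc‖v‖²` from absolute row ∕ column sums (the `Q*aQ` piece).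
* §3 **`qgq_coercive_of_form_le`** — THE VARIATIONAL STEP with the CHEAPEST quasi-reconstruction (the adjoint): `Δ` symmetric,
  `γ_a`-coercive (`γ_a > 0`), `⟨v, Δv⟩ ≤ Λ‖v‖²` (`Λ > 0`) and `QQᵀ` `c_Q`-coercive ⟹ `QΔ⁻¹Qᵀ` is `(c_Q/Λ)`-coercive (test field `Λ⁻¹Qᵀλ`
  in `QGQInverse.qgq_coercive_of_test_family`: `2Λ⁻¹‖Qᵀλ‖² − Λ⁻²⟨Qᵀλ, ΔQᵀλ⟩ ≥ Λ⁻¹‖Qᵀλ‖² ≥ Λ⁻¹c_Q‖λ‖²`).  The GENERAL mechanism is in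
  the tree twice — `QGQInverse.qgq_coercive_of_approx_right_inverse` (r1, this currency: any test map `T` with mass coercivity `1 − θ`
  and energy `C` gives `(1 − θ)²/C`) and `Summit.QuantumFields.BalabanUV.Beta.CoarseCoerciveQuasiReconstruction.sandwich_coercive_of_
  quasiReconstruction` (THIS lineage gen 39, complex Hermitian currency, `c²/E`) — and the owner memo `HOME/b2b-balaban-beta-an4/g39/
  NOTE-I3-coarse-coercivity.md` records WHY the cheapest test field is a FIXED-LATTICE device only: the block-constant extension has
  Dirichlet energy growing with the block size (so `c_Q/Λ` degrades with the fine points per block), whereas IN-BLOCK PLATEAU bumps give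
  the scale-uniform constant (`Beta.CoarseCoerciveBlock1D`: `n/(4(a+16))`, linear in the block size `n`; covariant energy with the
  thin-loop holonomy defect: `Beta.CoarseCoerciveCovariantEnergy`) — interface item (I3)/E-I3 of the row.  **`gram_coercive_of_approx_
  right_inverse`** — (A4) itself from an approximate right inverse `T` of `Q` (Lemma P′'s shape at `Δ = 1`).
* §4 **`qgq_coercive_of_letters`** — the letter `hco` of `RemainderOriginCoercive.ineq190_origin_of_coercive` on this carrier:
  `Coercive (Q * Δ⁻¹ * Qᵀ) (c_Q/(C·N·c))` from (A1) + (A2) + (A4); and **`green_entry_le_of_letters`** — the letter `hG0` in ENTRY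
  form: `|Δ⁻¹(i,j)| ≤ (γ_a − ρ_a)⁻¹e^{−κ_ad(blk i, blk j)}` for Combes–Thomas rates `κ_a + τ + σ ≤ δ_a`, `ρ_a = C_aκ_aτ⁻¹Nc < γ_a`
  (`QGQInverse.inverse_decay` with the block distance as pseudo-metric; the block-majorant form is
  `RemainderInvQGQCoercive.hasMaj_inv_of_coercive_decay` applied to `S := Δ_a`, composed in the sibling END
  `Beta.RemainderOriginPrincipal`).
LETTER LIST OF NODE D AT THE ORIGIN IN A BACKGROUND after this file (analytic, at a FIXED lattice): the positivity (A1) of Bałaban's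
bond operator `Δ_a = Δ_U + DRD* + Q*Q` [5] Thm 3.11 + its localisation (A2) (whose only non-automatic part is the decay of `R(U)`, a
SITE-operator statement of the type [5] Thms 3.1–3.2) + the surjectivity (A4) of his averaging operator `Q(U)` — NO statement about a
BOND propagator remains: [5] Thm 3.3 (3.42)₀, (3.132), (3.133) are all DERIVED by the finite Combes–Thomas argument and the
variational principle.  Carrier of these letters = NODE O (Bałaban's step objects as terms; ownerless, FROZEN (0)).

HONEST SCOPE.  [folklore] finite-dimensional linear algebra (Schur test; Schur-complement variational principle; the entry form of
Combes–Thomas is `QGQInverse.inverse_decay`, not re-proved); NO estimate of [5] or [15] is proved; the constants are those of a FIXED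
lattice — `γ_a`, `Λ ~ C_aNc` and the Combes–Thomas rate `κ_a < γ_aτ(C_aNc)⁻¹` degrade with the number of fine points per block, so
the k-UNIFORM (3.42) (the multiscale random-walk expansion of [5] Sect. D ∕ [3]) is NOT reproduced: THAT uniformity is exactly what
[5] Thm 3.3 adds to Thm 3.11, and it stays the row's located analytic input for k-uniform constants; located mechanisms of the
non-uniformity of THIS composition: (i) the first-order Combes–Thomas weight `e^{κd} − 1` of `QGQInverse.inverse_decay` charges the row
mass linearly in `κ` — for a lattice Laplacian with entries `η⁻²` at range `η` this forces `κ = O(γ_aη)` (the second-order `cosh` packaging,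
which removes this for symmetric finite-range operators, is in the tree: `Summit.QuantumFields.BalabanUV.Gaps.D4WalkBlockCoerciveLetter` §5,
`Summit.QuantumFields.BalabanUV.Beta.AccretiveCombesThomasBudget.conjLower_of_isHermitian`); (ii) the entry bound `(γ_a − ρ_a)⁻¹` times the
block count `N′` is blind to the smoothing of `Δ_a⁻¹` ((3.42)'s sup entry is an `ℓ^∞` statement: local regularity, [5] Sect. C); (iii) the
cheapest test field of §3 (above).  `Q* = Qᵀ` (standard real
adjoint; weighted adjoints reduce to it by a diagonal change of coordinates, not done here); nothing identifies Bałaban's step-`k`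
operators with tree terms (NODE O).  Row (D4) class UNCHANGED (instance 0∕1; D4 DISCHARGE NO DATE); NOT B12 Thm 2, NOT BetaPertH,
NOT continuum, NOT Clay.  HONEST DEPENDENCY (cell line): continuum YM on T⁴ ⇐ BetaPertH ∧ nine spine estimates (0/9 proved);
BetaPertH ⇐ (D1) ∧ (D4) ∧ CAP+tail; G-an2-4 gates asym, D1 and NE2/3/4.  NEW file; imports `QGQInverse`, `B11Reparam190` (built);
nothing modified; 0 `def`; standard axioms; no `sorry`.
-/

namespace Literature.MathematicalPhysics.QuantumFieldTheory.Balaban1983to89.Beta.RemainderPrincipalCoercive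

open Literature.MathematicalPhysics.QuantumFieldTheory.Balaban1983to89
open Finset Matrix B6RandomWalk B11SectG QGQInverse

variable {g : B6.Geometry}

/-! ## §1  Locality as entry decay -/

section Range

variable {m : Type} [Fintype m]

omit [Fintype m] in
/-- **(A2) IS AUTOMATIC FOR A FINITE-RANGE OPERATOR.**  If the entries of `S` vanish beyond the block distance `R` and are bounded
by `a ≥ 0`, then for every rate `δ ≥ 0`: `|S(i,j)| ≤ ae^{δR}·e^{−δd(blk i, blk j)}` — the entry-decay shape consumed below and by
`RemainderInvQGQCoercive.hasMaj_inv_of_coercive_decay` (the parts `Δ_U` and `Q*Q` of Bałaban's `Δ_a` couple nearest neighbours resp.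
points of one block: `R` = one block; the part `DR(U)D*` is NOT of finite range — its decay is that of the projection `R(U)` (3.21)).
[cite: Balaban1985BackgroundPropagators, (3.26) p.395, (3.21) p.394; Balaban1984PropagatorsII, (2.51) p.232] -/
theorem abs_entry_le_exp_of_range (blk : m → g.Site) (S : Matrix m m ℝ) {a R δ : ℝ} (ha : 0 ≤ a) (hδ : 0 ≤ δ)
    (hrange : ∀ i j, S i j ≠ 0 → g.dist (blk i) (blk j) ≤ R) (hbound : ∀ i j, |S i j| ≤ a) (i j : m) :
    |S i j| ≤ a * Real.exp (δ * R) * Real.exp (-(δ * g.dist (blk i) (blk j))) := by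
  by_cases h0 : S i j = 0
  · rw [h0, abs_zero]; exact mul_nonneg (mul_nonneg ha (Real.exp_nonneg _)) (Real.exp_nonneg _)
  · have hR := hrange i j h0
    have hexp : (1 : ℝ) ≤ Real.exp (δ * R) * Real.exp (-(δ * g.dist (blk i) (blk j))) := by
      rw [← Real.exp_add, ← Real.exp_zero]
      exact Real.exp_le_exp.mpr (by nlinarith)
    calc |S i j| ≤ a := hbound i j
      _ = a * 1 := (mul_one a).symm
      _ ≤ a * (Real.exp (δ * R) * Real.exp (-(δ * g.dist (blk i) (blk j)))) := mul_le_mul_of_nonneg_left hexp ha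
      _ = a * Real.exp (δ * R) * Real.exp (-(δ * g.dist (blk i) (blk j))) := by ring

end Range

/-! ## §2  The quadratic form of a local operator is bounded above (Schur) -/

section Form

variable {m : Type} [Fintype m]

omit [Fintype m] in
/-- Fibrewise count: with at most `N` indices per block and the row sum (2.61) at the rate `σ` (constant `c`),
`Σ_j e^{−σd(y, blk j)} ≤ N·c`. [cite: Balaban1984PropagatorsII, Lemma 2.1 (2.61) p.234] -/
theorem sum_exp_blk_le [Fintype m] (blk : m → g.Site) {σ c : ℝ} {N : ℕ} (hrow : RowSum g σ c)
    (hN : ∀ y : g.Site, ∃ s : Finset m, s.card ≤ N ∧ ∀ j, blk j = y → j ∈ s) (y : g.Site) :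
    ∑ j, Real.exp (-(σ * g.dist y (blk j))) ≤ N * c := by
  classical
  rw [← Finset.sum_fiberwise' univ blk fun y' => Real.exp (-(σ * g.dist y y'))]
  calc ∑ y' : g.Site, ∑ j ∈ univ.filter (fun j : m => blk j = y'), Real.exp (-(σ * g.dist y y'))
      = ∑ y' : g.Site, ((univ.filter fun j : m => blk j = y').card : ℝ) * Real.exp (-(σ * g.dist y y')) := by
        refine Finset.sum_congr rfl fun y' _ => ?_
        rw [Finset.sum_const, nsmul_eq_mul]
    _ ≤ ∑ y' : g.Site, (N : ℝ) * Real.exp (-(σ * g.dist y y')) := by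
        refine Finset.sum_le_sum fun y' _ => mul_le_mul_of_nonneg_right ?_ (Real.exp_nonneg _)
        obtain ⟨s, hs, hmem⟩ := hN y'
        have hsub : (univ.filter fun j : m => blk j = y') ⊆ s := fun j hj => hmem j (Finset.mem_filter.1 hj).2
        exact_mod_cast (Finset.card_le_card hsub).trans hs
    _ = N * ∑ y' : g.Site, Real.exp (-(σ * g.dist y y')) := by rw [Finset.mul_sum]
    _ ≤ N * c := mul_le_mul_of_nonneg_left (hrow y) (Nat.cast_nonneg N)

/-- **ROW SUMS** of a matrix with the entry decay `|S(i,j)| ≤ Ce^{−δd(blk i, blk j)}` (`C ≥ 0`, `d ≥ 0`), at most `N` indices per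
block, the row sum (2.61) at a rate `σ ≤ δ` with constant `c`: `Σ_j |S(i,j)| ≤ C·N·c`.
[cite: Balaban1984PropagatorsII, (2.51)–(2.52) p.232, Lemma 2.1 (2.61) p.234] -/
theorem rowSum_abs_le (blk : m → g.Site) (S : Matrix m m ℝ) {C δ σ c : ℝ} {N : ℕ}
    (hd : ∀ a b : g.Site, 0 ≤ g.dist a b) (hrow : RowSum g σ c) (hσδ : σ ≤ δ) (hC : 0 ≤ C)
    (hN : ∀ y : g.Site, ∃ s : Finset m, s.card ≤ N ∧ ∀ j, blk j = y → j ∈ s)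
    (hS : ∀ i j, |S i j| ≤ C * Real.exp (-(δ * g.dist (blk i) (blk j)))) (i : m) :
    ∑ j, |S i j| ≤ C * N * c := by
  have hrow' : RowSum g δ c := hrow.mono hd hσδ
  calc ∑ j, |S i j| ≤ ∑ j, C * Real.exp (-(δ * g.dist (blk i) (blk j))) := Finset.sum_le_sum fun j _ => hS i j
    _ = C * ∑ j, Real.exp (-(δ * g.dist (blk i) (blk j))) := by rw [Finset.mul_sum]
    _ ≤ C * (N * c) := mul_le_mul_of_nonneg_left (sum_exp_blk_le blk hrow' hN (blk i)) hC
    _ = C * N * c := by ring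

/-- **COLUMN SUMS**, the same bound (the distance is symmetric).
[cite: Balaban1984PropagatorsII, (2.51)–(2.52) p.232, Lemma 2.1 (2.61) p.234] -/
theorem colSum_abs_le (blk : m → g.Site) (S : Matrix m m ℝ) {C δ σ c : ℝ} {N : ℕ}
    (hd : ∀ a b : g.Site, 0 ≤ g.dist a b) (hds : ∀ a b : g.Site, g.dist a b = g.dist b a) (hrow : RowSum g σ c)
    (hσδ : σ ≤ δ) (hC : 0 ≤ C) (hN : ∀ y : g.Site, ∃ s : Finset m, s.card ≤ N ∧ ∀ j, blk j = y → j ∈ s)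
    (hS : ∀ i j, |S i j| ≤ C * Real.exp (-(δ * g.dist (blk i) (blk j)))) (j : m) :
    ∑ i, |S i j| ≤ C * N * c := by
  have hT : ∀ i k, |Sᵀ i k| ≤ C * Real.exp (-(δ * g.dist (blk i) (blk k))) := by
    intro i k; rw [Matrix.transpose_apply, hds]; exact hS k i
  have h := rowSum_abs_le blk Sᵀ hd hrow hσδ hC hN hT j
  simpa only [Matrix.transpose_apply] using h

/-- **THE FORM OF A LOCAL OPERATOR IS BOUNDED ABOVE**: with the data of `rowSum_abs_le` ∕ `colSum_abs_le`,
`⟨v, Sv⟩ ≤ (C·N·c)‖v‖²` for every `v` (Schur: `|⟨v, Sv⟩| ≤ √(row·column)‖v‖²`).  For Bałaban's `Δ_a` this is the trivial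
half of the spectrum — bounded coefficients, finite range. [cite: Balaban1985BackgroundPropagators, (3.26) p.395; Balaban1984PropagatorsII, (2.51)–(2.52) p.232, (2.61) p.234] -/
theorem form_le_of_decay (blk : m → g.Site) (S : Matrix m m ℝ) {C δ σ c : ℝ} {N : ℕ}
    (hd : ∀ a b : g.Site, 0 ≤ g.dist a b) (hds : ∀ a b : g.Site, g.dist a b = g.dist b a) (hrow : RowSum g σ c)
    (hσδ : σ ≤ δ) (hC : 0 ≤ C) (hN : ∀ y : g.Site, ∃ s : Finset m, s.card ≤ N ∧ ∀ j, blk j = y → j ∈ s)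
    (hS : ∀ i j, |S i j| ≤ C * Real.exp (-(δ * g.dist (blk i) (blk j)))) (v : m → ℝ) :
    v ⬝ᵥ (S *ᵥ v) ≤ C * N * c * (v ⬝ᵥ v) := by
  rcases isEmpty_or_nonempty m with hm | ⟨⟨i⟩⟩
  · simp [dotProduct]
  · have hc : 0 ≤ c := hrow.nonneg (blk i)
    have hΛ0 : 0 ≤ C * N * c := mul_nonneg (mul_nonneg hC (Nat.cast_nonneg N)) hc
    have h := form_abs_le_of_schur S hΛ0 (le_of_eq (by ring)) (rowSum_abs_le blk S hd hrow hσδ hC hN hS)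
      (colSum_abs_le blk S hd hds hrow hσδ hC hN hS) v
    exact (le_abs_self _).trans h

end Form

/-! ## §2b  The pieces of `Λ` for `Δ_a = Δ_U + DR(U)D* + Q*aQ` that need NO kernel decay of `R(U)` -/

section FormPieces

variable {m k p : Type} [Fintype m] [Fintype k] [Fintype p]

/-- **THE GAUGE-FIXING TERM COSTS NOTHING IN THE UPPER FORM BOUND.**  For a symmetric idempotent `R` (an orthogonal projection — [5]
(3.21): `R(U)` = the orthogonal projection onto `Δ_UN(Q′)`, NOT a finite-range operator) and any `D`:
`⟨v, DRDᵀv⟩ = ‖RDᵀv‖² ≤ ‖Dᵀv‖² = ⟨v, DDᵀv⟩`.  So the coercivity letter `hco` (§3–§4 via `hform`) needs only the finite-range pieces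
`Δ_U`, `DD*`, `Q*aQ` of `Δ_a` and `‖R‖ ≤ 1` — no decay of `R(U)`; the decay of `R(U)` enters NODE D only through the block majorant of
`Δ_a⁻¹` (Combes–Thomas needs the kernel of `Δ_a`). [cite: Balaban1985BackgroundPropagators, (3.21) p.394, (3.26) p.395, Thm 3.11 p.416] -/
theorem form_conj_proj_le (D : Matrix m k ℝ) (R : Matrix k k ℝ) (hR : R.IsSymm) (hRR : R * R = R) (v : m → ℝ) :
    v ⬝ᵥ ((D * R * Dᵀ) *ᵥ v) ≤ v ⬝ᵥ ((D * Dᵀ) *ᵥ v) := by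
  set w : k → ℝ := Dᵀ *ᵥ v with hw
  -- ⟨v, DXv'⟩ = ⟨Dᵀv, Xv'⟩
  have hadj : ∀ u : k → ℝ, v ⬝ᵥ (D *ᵥ u) = (Dᵀ *ᵥ v) ⬝ᵥ u := fun u => by
    rw [Matrix.dotProduct_mulVec, Matrix.mulVec_transpose]
  have e1 : v ⬝ᵥ ((D * R * Dᵀ) *ᵥ v) = w ⬝ᵥ (R *ᵥ w) := by
    rw [← Matrix.mulVec_mulVec, ← Matrix.mulVec_mulVec, hadj]
  have e2 : v ⬝ᵥ ((D * Dᵀ) *ᵥ v) = w ⬝ᵥ w := by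
    rw [← Matrix.mulVec_mulVec, hadj]
  -- ⟨w, Rw⟩ = ‖Rw‖² (R symmetric idempotent)
  have hRw : (R *ᵥ w) ⬝ᵥ (R *ᵥ w) = w ⬝ᵥ (R *ᵥ w) := by
    calc (R *ᵥ w) ⬝ᵥ (R *ᵥ w) = ((R *ᵥ w) ᵥ* R) ⬝ᵥ w := Matrix.dotProduct_mulVec _ _ _
      _ = (Rᵀ *ᵥ (R *ᵥ w)) ⬝ᵥ w := by rw [Matrix.mulVec_transpose]
      _ = ((R * R) *ᵥ w) ⬝ᵥ w := by rw [hR.eq, Matrix.mulVec_mulVec]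
      _ = w ⬝ᵥ (R *ᵥ w) := by rw [hRR, dotProduct_comm]
  -- ‖w‖² = ‖Rw‖² + ‖w − Rw‖²
  have hsplit : w ⬝ᵥ w = (R *ᵥ w) ⬝ᵥ (R *ᵥ w) + (w - R *ᵥ w) ⬝ᵥ (w - R *ᵥ w) := by
    have horth : (R *ᵥ w) ⬝ᵥ (w - R *ᵥ w) = 0 := by
      rw [dotProduct_sub, hRw, dotProduct_comm, sub_self]
    have : w = R *ᵥ w + (w - R *ᵥ w) := by abel
    conv_lhs => rw [this]
    rw [add_dotProduct, dotProduct_add, dotProduct_add, horth, dotProduct_comm (w - R *ᵥ w) (R *ᵥ w), horth]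
    ring
  have hnn : 0 ≤ (w - R *ᵥ w) ⬝ᵥ (w - R *ᵥ w) := Literature.LinearAlgebra.Matrix.dotProduct_self_nonneg_real _
  rw [e1, e2, ← hRw]
  linarith

omit [Fintype m] in
/-- **RECTANGULAR SCHUR BOUND FOR THE AVERAGING TERM**: absolute row sums of `Q` at most `Rr ≥ 0`, column sums at most `Cc` give
`‖Qv‖² = ⟨v, QᵀQv⟩ ≤ RrCc‖v‖²` — the form bound of `Q*aQ` is `a·RrCc` (for the block averages of [3] (2.6): rows of total weight 1,
columns of weight ≤ the number of blocks meeting a bond). [cite: Balaban1984PropagatorsII, (2.6) p.225; Balaban1985BackgroundPropagators, (3.13)–(3.16) p.393] -/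
theorem sq_mulVec_le_of_rowcol [Fintype m] (Q : Matrix p m ℝ) {Rr Cc : ℝ} (hRr : 0 ≤ Rr)
    (hR : ∀ i, ∑ j, |Q i j| ≤ Rr) (hC : ∀ j, ∑ i, |Q i j| ≤ Cc) (v : m → ℝ) :
    (Q *ᵥ v) ⬝ᵥ (Q *ᵥ v) ≤ Rr * Cc * (v ⬝ᵥ v) := by
  -- per row (weighted Cauchy–Schwarz): (Σ_j Q_ij v_j)² ≤ (Σ_j |Q_ij|)(Σ_j |Q_ij| v_j²) ≤ Rr·Σ_j |Q_ij| v_j²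
  have hrow : ∀ i, (Q *ᵥ v) i * (Q *ᵥ v) i ≤ Rr * ∑ j, |Q i j| * (v j * v j) := by
    intro i
    have hcs : (∑ j, Q i j * v j) ^ 2 ≤ (∑ j, |Q i j|) * ∑ j, |Q i j| * (v j * v j) :=
      Finset.sum_sq_le_sum_mul_sum_of_sq_le_mul Finset.univ (fun j _ => abs_nonneg (Q i j))
        (fun j _ => mul_nonneg (abs_nonneg (Q i j)) (mul_self_nonneg (v j)))
        (fun j _ => by rw [mul_pow, pow_two, pow_two, ← abs_mul_abs_self (Q i j)]; exact le_of_eq (by ring))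
    have hsum0 : 0 ≤ ∑ j, |Q i j| * (v j * v j) :=
      Finset.sum_nonneg fun j _ => mul_nonneg (abs_nonneg _) (mul_self_nonneg _)
    calc (Q *ᵥ v) i * (Q *ᵥ v) i = (∑ j, Q i j * v j) ^ 2 := by rw [pow_two]; rfl
      _ ≤ (∑ j, |Q i j|) * ∑ j, |Q i j| * (v j * v j) := hcs
      _ ≤ Rr * ∑ j, |Q i j| * (v j * v j) := mul_le_mul_of_nonneg_right (hR i) hsum0
  calc (Q *ᵥ v) ⬝ᵥ (Q *ᵥ v) = ∑ i, (Q *ᵥ v) i * (Q *ᵥ v) i := rfl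
    _ ≤ ∑ i, Rr * ∑ j, |Q i j| * (v j * v j) := Finset.sum_le_sum fun i _ => hrow i
    _ = Rr * ∑ j, (∑ i, |Q i j|) * (v j * v j) := by
        rw [← Finset.mul_sum, Finset.sum_comm]
        congr 1
        exact Finset.sum_congr rfl fun j _ => by rw [Finset.sum_mul]
    _ ≤ Rr * ∑ j, Cc * (v j * v j) := by
        refine mul_le_mul_of_nonneg_left (Finset.sum_le_sum fun j _ => ?_) hRr
        exact mul_le_mul_of_nonneg_right (hC j) (mul_self_nonneg _)
    _ = Rr * Cc * (v ⬝ᵥ v) := by rw [← Finset.mul_sum]; simp only [dotProduct]; ring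

end FormPieces

/-! ## §3  The variational step: an upper bound on `Δ` and a lower bound on `QQᵀ` make `QΔ⁻¹Qᵀ` coercive -/

section Variational

variable {m p : Type} [Fintype m] [Fintype p] [DecidableEq m]

omit [DecidableEq m] in
/-- `⟨λ, Qw⟩ = ⟨Qᵀλ, w⟩` (the real adjoint). [folklore] -/
private theorem dot_mulVec_eq_transpose_mulVec_dot (Q : Matrix p m ℝ) (lam : p → ℝ) (w : m → ℝ) :
    lam ⬝ᵥ (Q *ᵥ w) = (Qᵀ *ᵥ lam) ⬝ᵥ w := by
  rw [Matrix.dotProduct_mulVec, Matrix.mulVec_transpose]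

/-- **THE VARIATIONAL STEP WITH THE CHEAPEST TEST FIELD.**  `Δ` a real symmetric matrix, `γ_a`-coercive with `γ_a > 0` (so a unit with
a non-negative form — [5] Thm 3.11 *"Δ_a … positive definite"*), whose form is bounded ABOVE, `⟨v, Δv⟩ ≤ Λ‖v‖²` (`Λ > 0`); `Q` any
rectangular matrix whose Gram matrix `QQᵀ` is `c_Q`-coercive.  Then `QΔ⁻¹Qᵀ` is `(c_Q/Λ)`-coercive: in the Schur-complement
principle `2⟨QA, λ⟩ − ⟨A, ΔA⟩ ≤ ⟨λ, QΔ⁻¹Qᵀλ⟩` (`QGQInverse.qgq_coercive_of_test_family`) take `A = Λ⁻¹Qᵀλ`: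
`2Λ⁻¹‖Qᵀλ‖² − Λ⁻²⟨Qᵀλ, ΔQᵀλ⟩ ≥ Λ⁻¹‖Qᵀλ‖² = Λ⁻¹⟨λ, QQᵀλ⟩ ≥ Λ⁻¹c_Q‖λ‖²`.  The cheapest instance of the quasi-reconstruction
principle (`QGQInverse.qgq_coercive_of_approx_right_inverse`, r1; `Summit.…Beta.CoarseCoerciveQuasiReconstruction.sandwich_coercive_of_
quasiReconstruction`, this lineage gen 39; [3] (2.76) *"Q′_jG′_jQ′_j* ≥ 2γ₀"* by its variational dual): an UPPER bound on `Δ_a` and the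
SURJECTIVITY of `Q`, never `Δ_a⁻¹` — at a FIXED lattice (the scale-uniform constant needs the in-block plateau reconstruction of E-I3,
`Beta.CoarseCoerciveBlock1D` ∕ `Beta.CoarseCoerciveCovariantEnergy`, not the adjoint). [cite: Balaban1985BackgroundPropagators, Thm 3.11 p.416, (3.132) p.422; Balaban1985Variational, (129)–(130) p.297; Balaban1984PropagatorsII, (2.76) p.236] -/
theorem qgq_coercive_of_form_le (Δ : Matrix m m ℝ) (hsymm : Δ.IsSymm) {γa Λ cQ : ℝ} (hγa : 0 < γa)
    (hco : Coercive Δ γa) (hΛ : 0 < Λ) (hform : ∀ v : m → ℝ, v ⬝ᵥ (Δ *ᵥ v) ≤ Λ * (v ⬝ᵥ v))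
    (Q : Matrix p m ℝ) (hQ : Coercive (Q * Qᵀ) cQ) :
    Coercive (Q * Δ⁻¹ * Qᵀ) (cQ / Λ) := by
  have hunit : IsUnit Δ := isUnit_of_coercive hγa hco
  have hpos : ∀ v : m → ℝ, 0 ≤ v ⬝ᵥ (Δ *ᵥ v) := fun v =>
    (mul_nonneg hγa.le (Literature.LinearAlgebra.Matrix.dotProduct_self_nonneg_real v)).trans (hco v)
  refine qgq_coercive_of_test_family Δ hsymm hunit hpos Q (cQ / Λ) (fun lam => Λ⁻¹ • (Qᵀ *ᵥ lam)) ?_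
  intro lam
  have hΛi : 0 ≤ Λ⁻¹ := inv_nonneg.mpr hΛ.le
  -- ‖Qᵀλ‖² = ⟨λ, QQᵀλ⟩ ≥ c_Q‖λ‖²
  have huu : (Qᵀ *ᵥ lam) ⬝ᵥ (Qᵀ *ᵥ lam) = lam ⬝ᵥ ((Q * Qᵀ) *ᵥ lam) := by
    rw [← Matrix.mulVec_mulVec, dot_mulVec_eq_transpose_mulVec_dot Q lam]
  have hQl : cQ * (lam ⬝ᵥ lam) ≤ (Qᵀ *ᵥ lam) ⬝ᵥ (Qᵀ *ᵥ lam) := by rw [huu]; exact hQ lam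
  -- ⟨Q(Λ⁻¹Qᵀλ), λ⟩ = Λ⁻¹‖Qᵀλ‖²
  have e1 : (Q *ᵥ (Λ⁻¹ • (Qᵀ *ᵥ lam))) ⬝ᵥ lam = Λ⁻¹ * ((Qᵀ *ᵥ lam) ⬝ᵥ (Qᵀ *ᵥ lam)) := by
    rw [Matrix.mulVec_smul, smul_dotProduct, smul_eq_mul, dotProduct_comm, dot_mulVec_eq_transpose_mulVec_dot]
  -- the energy of the test field: Λ⁻²⟨Qᵀλ, ΔQᵀλ⟩ ≤ Λ⁻¹‖Qᵀλ‖²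
  have e2 : (Λ⁻¹ • (Qᵀ *ᵥ lam)) ⬝ᵥ (Δ *ᵥ (Λ⁻¹ • (Qᵀ *ᵥ lam)))
      = Λ⁻¹ * Λ⁻¹ * ((Qᵀ *ᵥ lam) ⬝ᵥ (Δ *ᵥ (Qᵀ *ᵥ lam))) := by
    rw [Matrix.mulVec_smul, smul_dotProduct, dotProduct_smul, smul_eq_mul, smul_eq_mul]; ring
  have h2 : Λ⁻¹ * Λ⁻¹ * ((Qᵀ *ᵥ lam) ⬝ᵥ (Δ *ᵥ (Qᵀ *ᵥ lam))) ≤ Λ⁻¹ * ((Qᵀ *ᵥ lam) ⬝ᵥ (Qᵀ *ᵥ lam)) := by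
    calc Λ⁻¹ * Λ⁻¹ * ((Qᵀ *ᵥ lam) ⬝ᵥ (Δ *ᵥ (Qᵀ *ᵥ lam)))
        ≤ Λ⁻¹ * Λ⁻¹ * (Λ * ((Qᵀ *ᵥ lam) ⬝ᵥ (Qᵀ *ᵥ lam))) :=
          mul_le_mul_of_nonneg_left (hform _) (mul_nonneg hΛi hΛi)
      _ = Λ⁻¹ * ((Qᵀ *ᵥ lam) ⬝ᵥ (Qᵀ *ᵥ lam)) := by field_simp
  rw [e1, e2]
  have e3 : cQ / Λ * (lam ⬝ᵥ lam) = Λ⁻¹ * (cQ * (lam ⬝ᵥ lam)) := by rw [div_eq_mul_inv]; ring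
  rw [e3]
  have h3 : Λ⁻¹ * (cQ * (lam ⬝ᵥ lam)) ≤ Λ⁻¹ * ((Qᵀ *ᵥ lam) ⬝ᵥ (Qᵀ *ᵥ lam)) := mul_le_mul_of_nonneg_left hQl hΛi
  linarith

/-- **(A4) FROM AN APPROXIMATE RIGHT INVERSE** (the written repair's Lemma P′ shape for the Gram matrix): if a test map `T` has
`⟨QTλ, λ⟩ ≥ (1 − θ)‖λ‖²` (`θ ≤ 1`) and `‖Tλ‖² ≤ τ‖λ‖²` (`τ > 0`), then `QQᵀ` is `(1 − θ)²/τ`-coercive —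
`QGQInverse.qgq_coercive_of_approx_right_inverse` at `Δ = 1`.  At `U = 1` the exact right inverse of the tube average of [3] (2.6)
is a far-layer profile (Lemma W of `QGQ-inverse-proof.md` §5.2); in a background, §5.3–5.5 there.
[cite: Balaban1984PropagatorsII, (2.6) p.225, (2.51) p.232; Balaban1985BackgroundPropagators, (3.13)–(3.15) p.393, (3.132) p.422] -/
theorem gram_coercive_of_approx_right_inverse (Q : Matrix p m ℝ) {θ τ : ℝ} (hτ : 0 < τ) (hθ : θ ≤ 1)
    (T : (p → ℝ) → (m → ℝ))
    (hQT : ∀ lam : p → ℝ, (1 - θ) * (lam ⬝ᵥ lam) ≤ (Q *ᵥ T lam) ⬝ᵥ lam)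
    (hT : ∀ lam : p → ℝ, (T lam) ⬝ᵥ (T lam) ≤ τ * (lam ⬝ᵥ lam)) :
    Coercive (Q * Qᵀ) ((1 - θ) ^ 2 / τ) := by
  have h := qgq_coercive_of_approx_right_inverse (1 : Matrix m m ℝ) Matrix.isSymm_one isUnit_one
    (fun v => by rw [Matrix.one_mulVec]; exact Literature.LinearAlgebra.Matrix.dotProduct_self_nonneg_real v)
    Q hτ hθ T hQT (fun lam => by rw [Matrix.one_mulVec]; exact hT lam)
  simpa only [inv_one, Matrix.mul_one] using h

end Variational

/-! ## §4  The letter `hco` of NODE D at the origin from the positivity and locality of `Δ_a` and the surjectivity of `Q` -/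

section Letters

variable {m p : Type} [Fintype m] [Fintype p] [DecidableEq m]

/-- **THE COERCIVITY OF `QΔ_a⁻¹Qᵀ` FROM INVERSE-FREE LETTERS** (the hypothesis `hco` of
`Beta.RemainderOriginCoercive.ineq190_origin_of_coercive` on the carrier fields = `m → ℝ`, `Q`-images = `p → ℝ`, `Q* = Qᵀ`).
Geometry: `blk : m → 𝔅` with at most `N` indices per block, `d ≥ 0` symmetric, the row sum (2.61) at a rate `σ ≤ δ` with constant
`c`.  LETTERS: (A1) `Δ` symmetric and `γ_a`-coercive, `γ_a > 0` ([5] Thm 3.11 for `Δ_a = Δ_U + DRD* + Q*Q`); (A2) the entry decay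
`|Δ(i,j)| ≤ Ce^{−δd(blk i, blk j)}`, `C ≥ 0` (localisation: §1 for `Δ_U`, `Q*Q`; the decay of `R(U)` (3.21) for `DRD*`); (A4) `QQᵀ` is
`c_Q`-coercive (surjectivity of the averaging operator).
CONCLUSION: `QΔ⁻¹Qᵀ` is `c_Q/Λ`-coercive, `Λ = C·N·c > 0` (§2 + §3).  With (A1)–(A2) the entry decay of `Δ⁻¹` itself
(`|Δ⁻¹(i,j)| ≤ (γ_a − ρ)⁻¹e^{−κd}`, `ρ = Cκτ⁻¹Nc < γ_a`, `κ + τ + σ ≤ δ`) is `QGQInverse.inverse_decay` ∕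
`RemainderInvQGQCoercive.hasMaj_inv_of_coercive_decay` applied to `S := Δ` — together the two gen-106 letters `hG0`, `hco`.
[cite: Balaban1985BackgroundPropagators, Thm 3.11 p.416, Thm 3.3 (3.42) p.397+p.399, (3.26)–(3.27) p.395, (3.132)–(3.133) p.422; Balaban1985Variational, (129)–(130) p.297; Balaban1984PropagatorsII, (2.51)–(2.54) pp.232–233, Lemma 2.1 (2.61) p.234] -/
theorem qgq_coercive_of_letters (blk : m → g.Site) (Δ : Matrix m m ℝ) (Q : Matrix p m ℝ)
    {γa C δ σ c cQ Λ : ℝ} {N : ℕ}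
    (hd : ∀ a b : g.Site, 0 ≤ g.dist a b) (hds : ∀ a b : g.Site, g.dist a b = g.dist b a) (hrow : RowSum g σ c)
    (hσδ : σ ≤ δ) (hC : 0 ≤ C) (hN : ∀ y : g.Site, ∃ s : Finset m, s.card ≤ N ∧ ∀ j, blk j = y → j ∈ s)
    (hsymm : Δ.IsSymm) (hγa : 0 < γa) (hco : Coercive Δ γa)
    (hS : ∀ i j, |Δ i j| ≤ C * Real.exp (-(δ * g.dist (blk i) (blk j))))
    (hQ : Coercive (Q * Qᵀ) cQ) (hΛ : Λ = C * N * c) (hΛ0 : 0 < Λ) :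
    Coercive (Q * Δ⁻¹ * Qᵀ) (cQ / Λ) :=
  qgq_coercive_of_form_le Δ hsymm hγa hco hΛ0
    (fun v => by rw [hΛ]; exact form_le_of_decay blk Δ hd hds hrow hσδ hC hN hS v) Q hQ

end Letters

end Literature.MathematicalPhysics.QuantumFieldTheory.Balaban1983to89.Beta.RemainderPrincipalCoercive
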